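import Literature.MathematicalPhysics.QuantumFieldTheory.Balaban1983to89.B9Eq326DeltaABlockDecayTowerTwoBackgroundsCurvQ
import Literature.MathematicalPhysics.QuantumFieldTheory.Balaban1983to89.B9Eq326DeltaAHQKLettersTower

/-!
# `Balaban1983to89.B9Eq326DeltaABlockDecayTowerTwoBackgroundsClosed` — T. Bałaban, *Propagators for lattice gauge theories in a background field*, Commun.
# Math. Phys. **99** (1985) 389–434 [Balaban1985BackgroundPropagators] (3.26) p. 395, (3.15)–(3.19) p. 393, (3.21)∕(3.25) p. 394, (3.49) p. 399, (3.69) p. 404,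
# Thm 3.11 p. 416, with [Balaban1985Variational] (110) p. 294: **THE BIG-BLOCK `L²` DECAY OF `G₁,k(V) − G₁,k(U)`, EVERY HEIGHT, WITH THE SINGLE-BACKGROUND
# CONJUGATION BUNDLES `hQKU` ∕ `hQKV`, THE CURVATURE FLOORS AND THE `C_P` LETTERS DISCHARGED** — `B9Eq326DeltaABlockDecayTowerTwoBackgroundsCurvQ.
# norm_block_G1k_sub_G1k_le_lipschitz_curv_Q` (this lineage, gen 90: `δ_Q` ∕ `δ_Q′` discharged) with `hQKU := hQK_of_chain_tower (U)`, `hQKV := hQK_of_chain_tower (V)`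
# (the NE9 OWNER lineage gen 94's `B9Eq326DeltaAHQKLettersTower`, at both backgrounds), `hKre• :=` g92's `re_inner_curvOp_self_ge`, `hP• :=` the tower
# `C_P` letter `B9Eq325ProjectionDivergenceQuarterKappaTower.norm_one_sub_RofUk_covDivL2K_le_sqrt` — exactly as gen 94's single-background corollary
# `norm_block_G1k_le_closed` closes (GBT2).  DISPLAYED after this file: `γ` + `hpos` at `U` and at `V` (Thm 3.11 for `Δ_{a,k}`), `γ′, a′, hpos′, κ₁, M` at
# `U` and at `V` (the `G′_k` side), the MODEL letters (bond ∕ plaquette smallness and closeness, the level averages' `U1`-membership, smallness profile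
# `ε_j ≤ α_bϱ^j` and closeness profile `δ_j ≤ δϱ^j`), the CLOSED windows, and — of the conjugated two-background letters — `δ_R` ALONE

statement-level skeleton of published theorems with citation tags; proofs where landed; nothing here is a claim about the Yang–Mills mass gap

PDF held: `paper:balaban1985-cmp99-background-propagators` (journal page = PDF page + 388); pp. 393–395, 399, 404, 416 read through the suppliers' headers.

CITATION HEADER (lean-in-tree rule 2026-08-18).  Audit cell `pub-balaban`, sub-cell `t4`, NE9 crux team (2): LEAF PROVER 01 (`b2b-balaban-t4-ne9-formalise-leaf-01`
gen 90), I-7 = the N52 road (α) END CLOSED on the single-background side.  WHY: I-5 still displayed, besides `δ_R`, the two single-background conjugation bundles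
`hQKU`, `hQKV` (`dQ ∧ dQ′ ∧ dK ∧ dR` at `U` and at `V`), the curvature floors `hKreU`∕`hKreV` and the projection-divergence letters `hPU`∕`hPV`; every one of
them has a supplier IN THE TREE for one background (the OWNER g94's (HQKT) `hQK_of_chain_tower`, g92's `B9Eq369CurvFormL2.re_inner_curvOp_self_ge`, the
tower `C_P` letter) — applied here twice.  TEMPLATE CREDITED: `B9Eq326DeltaAHQKLettersTower.norm_block_G1k_le_closed` (its discharge pattern verbatim, at `U`
and at `V`).

WHAT IS PROVED (sorry-free; 0 `def`; [folklore] composition BY NAME; nothing of [B9] asserted as printed).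
* **`norm_block_G1k_sub_G1k_le_closed`** — I-5's theorem with `hQKU`, `hQKV`, `hKreU`, `hKreV`, `hPU`, `hPV` GONE (`p_K := 768·#DirPair·M_τM_φ²(|η|^d∕c₀)|η|⁻²·δ_pl`,
  `C_P := √(M∕√κ₁)` substituted in the route smallness `small`), in exchange for the (HQKT) binders at both backgrounds: the trace product bound `hτ2`, the
  plaquette letters `reHol`∕`imHol` (`δ_pl`), the `G′_k` side (`hpos′`, `γ′`-coercivity, `κ₁`-floor, `M`) at `U` and at `V`, and the CLOSED windows `rℓ′ ≤ 1`,
  `hβT` (the tower `dQ` product difference `≤ β`), `hβKw`, `hβ′D`, `hβ′Q`, `smallG`, `hwinκ`, `hρw`.  The conclusion is I-13's ∕ I-5's with `C_P := √(M∕√κ₁)` substituted (five occurrences), nothing else changed.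
MODEL ∕ DECLARED READINGS.  Those of I-5 and of `B9Eq326DeltaAHQKLettersTower`; the same penalty `a′` on the `G′_k` side as in the `R_k`-Lipschitz supplier.
HONEST SCOPE.  [folklore] two bundles re-assembled; the windows are CLOSED but not solved for `r` (the reader's: `β ∝ rℓ`, `β_K ∝ rℓη·p_K`, `ρ ∝ β′∕√κ₁`, and the
tower `dQ` window's height-free reading by the OWNER g94's `norm_expConj_QkW_sub_le_linear` ∕ this lineage's `…TwoBackgroundsLinear`); `γ`, `γ′`, `κ₁`, `M`,
`hpos`, `hpos′` DISPLAYED (Thm 3.11 currency); `δ_R` DISPLAYED ((PDC)-type two backgrounds, located, unclaimed); «NE9 ⇐ the named binders»; NE9 NOT PRINTED ∕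
NOT PROVED; NOT summit progress (cell pub-balaban: row NE9 WALLED ON A MODEL (O-NE9-1; #5 UNRULED); spine PROVED 0∕9; rung (B)+1 finite T⁴ — NOT infinite
volume, NOT mass gap, NOT BetaPertH, NOT Clay; HONEST DEPENDENCY: continuum YM on T⁴ ⇐ BetaPertH ∧ nine spine estimates (0/9 proved); BetaPertH ⇐ (D1) ∧ (D4) ∧
CAP+tail; G-an2-4 gates asym, D1 and NE2/3/4).  NEW file; nothing modified.  Net new unproved facts: 0.
-/

noncomputable section

open scoped InnerProductSpace ComplexConjugate BigOperators
open NormedSpace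

namespace Literature.MathematicalPhysics.QuantumFieldTheory.Balaban1983to89.B9Eq326DeltaABlockDecayTowerTwoBackgroundsClosed

open B4Sect5Torus (TSite tdist)
open B9SectCLatticeCarrier (Bond bpos btgt)
open B9Eq311L2Pairing (WL2)
open B9Eq319QprimeTorus (blockCoord)
open B9Eq315QTower (towerP)
open B9Eq315QTorus (perCfg cornerSite)
open B7Prop1Explicit (Wcx boxVec)
open B9Eq316TowerFlatIsOneStep (siteCast siteCast_rfl towerP_eq_fineP_pow)
open B7Prop1Explicit (U1)
open B11Eq103H1Complex (SiteL2K BondL2K covDivL2K)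
open B9Eq310HessianOperator (adTransportW PlaqL2K curvOp)
open B9Eq310DeltaPrime (plaqHolU)
open B9Eq326OperatorTower (laplaceAk RofUk G1k QkW)
open B9SectCLatticeCarrier (DirPair)
open B9Eq310DeltaPrime (reHol imHol)
open B11Eq103H1Complex (covDerivL2K)
open B9Eq326OperatorTower (QprimeTowerW)
open B9Eq324DeltaPrimeATower (laplacePrimeAk GpOfUk)
open B9Eq326DeltaABlockDecayTowerTwoBackgroundsCurvQ (norm_block_G1k_sub_G1k_le_lipschitz_curv_Q)
open B9Eq326DeltaAHQKLettersTower (hQK_of_chain_tower)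
open B9Eq369CurvFormL2 (re_inner_curvOp_self_ge)
open B9Eq325ProjectionDivergenceQuarterKappaTower (norm_one_sub_RofUk_covDivL2K_le_sqrt)

variable {d : ℕ} {L : ℕ} [NeZero L] {m : Fin d → ℕ} [∀ i, NeZero (m i)] {n : ℕ}
  {𝔸 : Type*} [NormedRing 𝔸] [StarRing 𝔸] [NormedAlgebra ℂ 𝔸] [StarModule ℂ 𝔸] [CompleteSpace 𝔸] [NormOneClass 𝔸]
  {W : Type*} [NormedAddCommGroup W] [InnerProductSpace ℂ W] [FiniteDimensional ℂ W] (φ : W ≃ₗ[ℂ] 𝔸) {Mφ Mφ' : ℝ}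
  (hφ : ∀ w, ‖φ w‖ ≤ Mφ * ‖w‖) (hφ' : ∀ X, ‖φ.symm X‖ ≤ Mφ' * ‖X‖) (hMφ : 0 ≤ Mφ) (hMφ' : 0 ≤ Mφ')
  {c₀ : ℝ} [Fact (0 < c₀)] {c₁ : ℝ} [Fact (0 < c₁)] {η : ℝ} (hη : 0 < η) (hηL : η * (L : ℝ) ^ (n + 1) = 1)
  (U V : Bond d (towerP L m (n + 1)) → 𝔸ˣ) (hU : ∀ b, U b ∈ U1 𝔸) (hV : ∀ b, V b ∈ U1 𝔸)
  (hRSU : ∀ (b : Bond d (towerP L m (n + 1))) (v u : W), ⟪adTransportW φ U b v, u⟫_ℂ = ⟪v, adTransportW φ (fun b => (U b)⁻¹) b u⟫_ℂ)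
  (hRSV : ∀ (b : Bond d (towerP L m (n + 1))) (v u : W), ⟪adTransportW φ V b v, u⟫_ℂ = ⟪v, adTransportW φ (fun b => (V b)⁻¹) b u⟫_ℂ)
  (τ : 𝔸 →ₗ[ℂ] ℂ) (hL : 1 ≤ L) (α : ℕ → ℝ) (hα1 : ∀ j, α j ≤ 1 / 64)
  (hU1U : ∀ (j : ℕ) (x : B7Prop1Explicit.Site d) (κ : Fin d), perCfg (towerP L m (j + 1)) (B9Eq315QTower.UlevOf L m (n + 1) U j) x κ ∈ U1 𝔸)
  (hregU : ∀ (j : ℕ) (y : TSite d (towerP L m j)) (κ : Fin d) (r : Fin d → Fin L),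
    ‖((Wcx L (perCfg (towerP L m (j + 1)) (B9Eq315QTower.UlevOf L m (n + 1) U j)) (cornerSite L y) κ (boxVec L r) : 𝔸ˣ) : 𝔸) - 1‖ ≤ α j)
  (hU1V : ∀ (j : ℕ) (x : B7Prop1Explicit.Site d) (κ : Fin d), perCfg (towerP L m (j + 1)) (B9Eq315QTower.UlevOf L m (n + 1) V j) x κ ∈ U1 𝔸)
  (hregV : ∀ (j : ℕ) (y : TSite d (towerP L m j)) (κ : Fin d) (r : Fin d → Fin L),
    ‖((Wcx L (perCfg (towerP L m (j + 1)) (B9Eq315QTower.UlevOf L m (n + 1) V j)) (cornerSite L y) κ (boxVec L r) : 𝔸ˣ) : 𝔸) - 1‖ ≤ α j)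
  (a : ℝ)

include hφ hφ' hMφ hMφ' hη hηL hU hV hRSU hRSV in
/-- **THE BIG-BLOCK `L²` DECAY OF `G₁,k(V) − G₁,k(U)` WITH EVERY SINGLE-BACKGROUND CONJUGATION LETTER DISCHARGED**: I-5's
`norm_block_G1k_sub_G1k_le_lipschitz_curv_Q` with `hQKU`∕`hQKV := hQK_of_chain_tower` at `U`∕`V`, `hKre• := re_inner_curvOp_self_ge`, `hP• :=` the tower `C_P`
letter. Displayed: Thm 3.11-currency letters at both backgrounds, the MODEL letters, the CLOSED windows, `δ_R`. [folklore]
[cite: Balaban1985BackgroundPropagators, (3.26) p.395, (3.15)–(3.19) p.393, (3.21) p.394, (3.25) p.394, (3.49) p.399, (3.69) p.404, Thm 3.11 p.416; Balaban1985Variational, (110) p.294] -/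
theorem norm_block_G1k_sub_G1k_le_closed (ha : 0 ≤ a) (hm : ∀ i, 1 ≤ m i)
    (hposU : ∀ x : BondL2K ℂ d (towerP L m (n + 1)) c₀ W, x ≠ 0 → 0 < RCLike.re ⟪x, laplaceAk L m n φ η U hL α hα1 hU1U hregU τ (c₀ := c₀) (c₁ := c₁) a x⟫_ℂ)
    (hposV : ∀ x : BondL2K ℂ d (towerP L m (n + 1)) c₀ W, x ≠ 0 → 0 < RCLike.re ⟪x, laplaceAk L m n φ η V hL α hα1 hU1V hregV τ (c₀ := c₀) (c₁ := c₁) a x⟫_ℂ)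
    {γ β βK ℓ ℓ' r ρ : ℝ} (hγ : 0 < γ) (hβ : 0 ≤ β) (hℓ : 1 ≤ ℓ) (hℓ' : 1 ≤ ℓ') (hr : 0 ≤ r) (hρ : 0 ≤ ρ) (hρ8 : ρ ≤ 1 / 8)
    (hcoerU : ∀ f : BondL2K ℂ d (towerP L m (n + 1)) c₀ W, γ * ‖f‖ ^ 2 ≤ RCLike.re ⟪f, laplaceAk L m n φ η U hL α hα1 hU1U hregU τ (c₀ := c₀) (c₁ := c₁) a f⟫_ℂ)
    (hcoerV : ∀ f : BondL2K ℂ d (towerP L m (n + 1)) c₀ W, γ * ‖f‖ ^ 2 ≤ RCLike.re ⟪f, laplaceAk L m n φ η V hL α hα1 hU1V hregV τ (c₀ := c₀) (c₁ := c₁) a f⟫_ℂ)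
    (hwin : r * ℓ * η ≤ 1)
    (hβCC : 4 * r * ℓ * (Mφ * Mφ') * (d * Real.sqrt d) ≤ β) (hβC : 4 * r * ℓ * (Mφ * Mφ') * d ≤ β)
    (hβD : 2 * r * ℓ * (Mφ * Mφ') * Real.sqrt d ≤ β)
    {δR : ℝ} (hδR : 0 ≤ δR)
    (hTR : ∀ (χ : TSite d (towerP L m (n + 1)) → ℝ) (χ' : TSite d m → ℝ),
      (∀ b : Bond d (towerP L m (n + 1)), |χ (bpos b) - χ (btgt b)| ≤ ℓ * η) →
      (∀ (y : TSite d m) (x : TSite d (towerP L m (n + 1))),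
        siteCast (towerP_eq_fineP_pow L m (n + 1)) x ∈ B9Eq319QprimeTorus.blockOf (L ^ (n + 1)) m y → |χ' y - χ x| ≤ ℓ') →
      ∀ (MB : BondL2K ℂ d (towerP L m (n + 1)) c₀ W →L[ℂ] BondL2K ℂ d (towerP L m (n + 1)) c₀ W),
      (∀ (g : BondL2K ℂ d (towerP L m (n + 1)) c₀ W) (b : Bond d (towerP L m (n + 1))),
        WL2.equiv ℂ (fun _ : Bond d (towerP L m (n + 1)) => c₀) W (MB g) b = (χ (bpos b) : ℂ) • WL2.equiv ℂ (fun _ : Bond d (towerP L m (n + 1)) => c₀) W g b) →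
      ∀ (MS : SiteL2K ℂ d (towerP L m (n + 1)) c₀ W →L[ℂ] SiteL2K ℂ d (towerP L m (n + 1)) c₀ W),
      (∀ (g : SiteL2K ℂ d (towerP L m (n + 1)) c₀ W) (x : TSite d (towerP L m (n + 1))),
        WL2.equiv ℂ (fun _ : TSite d (towerP L m (n + 1)) => c₀) W (MS g) x = (χ x : ℂ) • WL2.equiv ℂ (fun _ : TSite d (towerP L m (n + 1)) => c₀) W g x) →
      ∀ (MF : BondL2K ℂ d m c₁ W →L[ℂ] BondL2K ℂ d m c₁ W),
      (∀ (g : BondL2K ℂ d m c₁ W) (b' : Bond d m),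
        WL2.equiv ℂ (fun _ : Bond d m => c₁) W (MF g) b' = (χ' (bpos b') : ℂ) • WL2.equiv ℂ (fun _ : Bond d m => c₁) W g b') →
      ∀ κ : ℂ, ‖κ‖ = r →
      (∀ s, ‖exp (κ • MS) (RofUk L m n φ η V (c₀ := c₀) (exp (κ • (-MS)) s)) - exp (κ • MS) (RofUk L m n φ η U (c₀ := c₀) (exp (κ • (-MS)) s))‖ ≤ δR * ‖s‖))
    -- the bond closeness of the two backgrounds, and the TREE's binders for the two Lipschitz letters `e_R`, `e_Q` (now DISCHARGED):
    {δ : ℝ} (hδ : 0 ≤ δ) (hUV : ∀ b, ‖(U b : 𝔸) - (V b : 𝔸)‖ ≤ δ * η)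
    -- ne9-leaf-04 g81's binders for the conjugated `Δ′` letter (`B9Eq369CurvFormConjugationTwoBackgrounds` §4, two closeness letters): the involution
    -- and trace bounds, the plaquette window `ε` of `U`, the plaquette closeness `δ_p`
    (hstar : ∀ X : 𝔸, ‖star X‖ ≤ ‖X‖) {Cτ : ℝ} (hτ : ∀ X, ‖τ X‖ ≤ Cτ * ‖X‖) (hCτ : 0 ≤ Cτ)
    -- g92's curvature-form floor at both backgrounds: the product bound of the trace and the plaquette letters `reHol`, `imHol`
    {Mτ : ℝ} (hτ2 : ∀ X Y : 𝔸, ‖τ (X * Y)‖ ≤ Mτ * ‖X‖ * ‖Y‖) (hMτ : 0 ≤ Mτ) {δpl : ℝ} (hδpl : 0 ≤ δpl)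
    (hReU : ∀ p : B9SectCLatticeCarrier.Plaq d (towerP L m (n + 1)), ‖reHol U p - 1‖ ≤ δpl)
    (hImU : ∀ p : B9SectCLatticeCarrier.Plaq d (towerP L m (n + 1)), ‖imHol U p‖ ≤ δpl)
    (hReV : ∀ p : B9SectCLatticeCarrier.Plaq d (towerP L m (n + 1)), ‖reHol V p - 1‖ ≤ δpl)
    (hImV : ∀ p : B9SectCLatticeCarrier.Plaq d (towerP L m (n + 1)), ‖imHol V p‖ ≤ δpl)
    {ε : ℝ} (hε : 0 ≤ ε) (hpl : ∀ p : B9SectCLatticeCarrier.Plaq d (towerP L m (n + 1)), ‖(plaqHolU U p : 𝔸) - 1‖ ≤ ε)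
    {δp : ℝ} (hδp : 0 ≤ δp) (hpp : ∀ p : B9SectCLatticeCarrier.Plaq d (towerP L m (n + 1)), ‖(plaqHolU U p : 𝔸) - (plaqHolU V p : 𝔸)‖ ≤ δp)
    -- (3.16)'s weight relation, the bond smallness of both backgrounds, the common level profiles (`B9Eq325RLipschitzSqrtTowerTwoBackgroundsLinear`'s binders)
    (hw : c₀ * ((L : ℝ) ^ (n + 1)) ^ d = c₁) {a' : ℝ} (ha' : 0 < a') {αb : ℝ} (hαb : 0 ≤ αb)
    -- the `G′_k` side of the `dR` chain and of the tower `C_P` letter, at both backgrounds (ne9-leaf-03's (PDCT), the OWNER's (HQKT) binders verbatim)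
    (hpos'U : ∀ x : SiteL2K ℂ d (towerP L m (n + 1)) c₀ W, x ≠ 0 → 0 < RCLike.re ⟪x, laplacePrimeAk L m n φ η U a' (c₁ := c₁) x⟫_ℂ)
    (hpos'V : ∀ x : SiteL2K ℂ d (towerP L m (n + 1)) c₀ W, x ≠ 0 → 0 < RCLike.re ⟪x, laplacePrimeAk L m n φ η V a' (c₁ := c₁) x⟫_ℂ)
    {γ' κ₁ M : ℝ} (hγ' : 0 < γ') (hγ'1 : γ' ≤ 1) (hκ₁ : 0 < κ₁) (hM : 0 ≤ M)
    (coerciveU : ∀ f : SiteL2K ℂ d (towerP L m (n + 1)) c₀ W, γ' * ‖f‖ ^ 2 ≤ ‖(covDerivL2K ℂ c₀ ((η : ℂ))⁻¹ (adTransportW φ U)) f‖ ^ 2 +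
      a' * ‖((WL2.linearEquiv ℂ ℂ (fun _ : TSite d m => c₁)).symm.toLinearMap ∘ₗ QprimeTowerW L m n φ U (c₀ := c₀)) f‖ ^ 2)
    (coerciveV : ∀ f : SiteL2K ℂ d (towerP L m (n + 1)) c₀ W, γ' * ‖f‖ ^ 2 ≤ ‖(covDerivL2K ℂ c₀ ((η : ℂ))⁻¹ (adTransportW φ V)) f‖ ^ 2 +
      a' * ‖((WL2.linearEquiv ℂ ℂ (fun _ : TSite d m => c₁)).symm.toLinearMap ∘ₗ QprimeTowerW L m n φ V (c₀ := c₀)) f‖ ^ 2)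
    (hκU : ∀ ψ : SiteL2K ℂ d m c₁ W, κ₁ * ‖ψ‖ ^ 2 ≤ RCLike.re ⟪ψ,
      (((WL2.linearEquiv ℂ ℂ (fun _ : TSite d m => c₁)).symm.toLinearMap ∘ₗ QprimeTowerW L m n φ U (c₀ := c₀)) ∘ₗ
        GpOfUk L m n φ η U a' (c₁ := c₁) hpos'U ∘ₗ GpOfUk L m n φ η U a' (c₁ := c₁) hpos'U ∘ₗ
        LinearMap.adjoint ((WL2.linearEquiv ℂ ℂ (fun _ : TSite d m => c₁)).symm.toLinearMap ∘ₗ QprimeTowerW L m n φ U (c₀ := c₀))) ψ⟫_ℂ)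
    (hκV : ∀ ψ : SiteL2K ℂ d m c₁ W, κ₁ * ‖ψ‖ ^ 2 ≤ RCLike.re ⟪ψ,
      (((WL2.linearEquiv ℂ ℂ (fun _ : TSite d m => c₁)).symm.toLinearMap ∘ₗ QprimeTowerW L m n φ V (c₀ := c₀)) ∘ₗ
        GpOfUk L m n φ η V a' (c₁ := c₁) hpos'V ∘ₗ GpOfUk L m n φ η V a' (c₁ := c₁) hpos'V ∘ₗ
        LinearMap.adjoint ((WL2.linearEquiv ℂ ℂ (fun _ : TSite d m => c₁)).symm.toLinearMap ∘ₗ QprimeTowerW L m n φ V (c₀ := c₀))) ψ⟫_ℂ)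
    (hMQU : ∀ s : SiteL2K ℂ d (towerP L m (n + 1)) c₀ W,
      ‖((WL2.linearEquiv ℂ ℂ (fun _ : TSite d m => c₁)).symm.toLinearMap ∘ₗ QprimeTowerW L m n φ U (c₀ := c₀)) s‖ ≤ M * ‖s‖)
    (hMQV : ∀ s : SiteL2K ℂ d (towerP L m (n + 1)) c₀ W,
      ‖((WL2.linearEquiv ℂ ℂ (fun _ : TSite d m => c₁)).symm.toLinearMap ∘ₗ QprimeTowerW L m n φ V (c₀ := c₀)) s‖ ≤ M * ‖s‖)
    -- the route's smallness with `p_K` and `C_P` at their suppliers' values (g92's curvature-form floor; the tower `C_P = √(M∕√κ₁)`)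
    (small : 3 / 4 * (768 * Fintype.card (DirPair d) * Mτ * Mφ ^ 2 * (‖((η : ℂ)) ^ d‖ / c₀) * ‖((η : ℂ))⁻¹‖ ^ 2 * δpl) + (21 + 3 * a) * β ^ 2 +
      4 * β * Real.sqrt (M / Real.sqrt κ₁) + 2 * ρ * Real.sqrt (M / Real.sqrt κ₁) ^ 2 + βK ≤ γ / 8)
    (hUε : ∀ b, ‖(U b : 𝔸) - 1‖ ≤ αb * η) (hVε : ∀ b, ‖(V b : 𝔸) - 1‖ ≤ αb * η)
    (εU δUV : ℕ → ℝ) (hεU : ∀ j, 0 ≤ εU j) (hδUV : ∀ j, 0 ≤ δUV j)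
    (hLεU : ∀ (j : ℕ) (b : Bond d (towerP L m (j + 1))), ‖(B9Eq315QTower.UlevOf L m (n + 1) U j b : 𝔸) - 1‖ ≤ εU j)
    (hLεV : ∀ (j : ℕ) (b : Bond d (towerP L m (j + 1))), ‖(B9Eq315QTower.UlevOf L m (n + 1) V j b : 𝔸) - 1‖ ≤ εU j)
    (hLbU : ∀ (j : ℕ) (b : Bond d (towerP L m (j + 1))), B9Eq315QTower.UlevOf L m (n + 1) U j b ∈ U1 𝔸)
    (hLbV : ∀ (j : ℕ) (b : Bond d (towerP L m (j + 1))), B9Eq315QTower.UlevOf L m (n + 1) V j b ∈ U1 𝔸)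
    (hLUV : ∀ (j : ℕ) (b : Bond d (towerP L m (j + 1))), ‖(B9Eq315QTower.UlevOf L m (n + 1) U j b : 𝔸) - (B9Eq315QTower.UlevOf L m (n + 1) V j b : 𝔸)‖ ≤ δUV j)
    {rp α₀ δ₀ : ℝ} (hrp0 : 0 ≤ rp) (hrp1 : rp < 1) (hαα₀ : αb ≤ α₀) (hδ₀ : 0 < δ₀)
    (hεg : ∀ j < n + 1, εU j ≤ αb * rp ^ j) (hδg : ∀ j < n + 1, δUV j ≤ δ * rp ^ j)
    {sD sQ θb δbD γR θbG δbA sS sV s₂ sG₂ sA₂ : ℝ}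
    (hsD : sD = Real.sqrt d * (2 * Mφ * Mφ'))
    (hsQ : sQ = 2 * (((d * (L - 1) : ℕ) : ℝ) * (2 * Mφ * Mφ') / (1 - rp)))
    (hθb : θb = sQ * α₀) (hδbD : δbD = sD * α₀)
    (hγRdef : γR = 1 / (2 + 2 / a') - (δbD + δbD ^ 2 + a' * θb * (2 * 1 + θb)))
    (hθbG : θbG = 2 * δbD * (γR⁻¹ * (Real.sqrt γR)⁻¹) + (|a'| * θb * ((1 + θb) + 1)) * γR⁻¹ ^ 2)
    (hδbA : δbA = θbG * (1 + θb) + (2 + 2 / a') * θb)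
    (hsS : sS = Real.sqrt (1 / (12 * (d : ℝ) * (6 / 5) ^ (d - 1) + a') ^ 2)) (hsV : sV = sS - δbA)
    (hs₂ : s₂ = 2 * Real.exp ((d * (L - 1) : ℕ) * (2 * Mφ * Mφ' * α₀ / (1 - rp))) *
      ((d * (L - 1) : ℕ) * (2 * Mφ * Mφ') * (1 + 2 * Mφ * Mφ' * α₀) ^ (d * (L - 1)) / (1 - rp)))
    (hsG₂ : sG₂ = 2 * sD * (γR⁻¹ * (Real.sqrt γR)⁻¹) + (|a'| * s₂ * ((1 + θb) + (1 + θb))) * γR⁻¹ ^ 2)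
    (hsA₂ : sA₂ = sG₂ * (1 + θb) + γR⁻¹ * s₂)
    (hc1 : ((d * (L - 1) : ℕ) : ℝ) * (2 * Mφ * Mφ') / (1 - rp) * α₀ ≤ 1) (hγR : 0 < γR) (hDγ : δbD ≤ 1 / (2 + 2 / a')) (hsV0 : 0 < sV)
    (hB : ((d * (L - 1) : ℕ) * (2 * Mφ * Mφ') * (1 + 2 * Mφ * Mφ' * α₀) ^ (d * (L - 1)) / (1 - rp)) * δ₀ ≤ 1) (hwinR : 2 * sA₂ * δ₀ ≤ sV)
    -- `B9Eq315QTowerLipschitzL2TwoBackgroundsChain`'s extra binders (the `Q_k` letter)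
    (hα128 : ∀ j, α j ≤ 1 / 128) (hδmax : ∀ j, δUV j ≤ 1 / (12288 * ((2 * (d * L) + L + L : ℕ) : ℝ)))
    (hwinQ : Real.sqrt ((L : ℝ) ^ d) * (Real.sqrt (2 * d) * (75497472 * ((d : ℝ) + 1) * ((2 * (d * L) + L + L : ℕ) : ℝ))) / (1 - rp) * δ ≤ 1)
    -- the two windows of the conjugated two-background `Q_k` letters (the companion's, at `ι := ℓη`) and their constant `δ_Q(r)` as a definitional binder
    (hwinQ0 : r * (3 * ℓ' + (L : ℝ) ^ (n + 1) * (ℓ * η)) ≤ 1) (hwinQ1 : r * (2 * d * (L : ℝ) ^ n * (ℓ * η)) ≤ 1)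
    -- the CLOSED windows of the four conjugation letters (the OWNER's (HQKT) `hQK_of_chain_tower`, at the radius `r` and the common level profile `ε_j`)
    (hwin' : r * ℓ' ≤ 1) {β' : ℝ} (hβ'0 : 0 ≤ β') (hβ'1 : β' ≤ 1)
    (hβT : Mφ' * Mφ * Real.sqrt (c₁ / (c₀ * ((L : ℝ) ^ (n + 1)) ^ d)) *
      ((∏ j ∈ Finset.range (n + 1), (1 + Real.sqrt ((L : ℝ) ^ d) * (Real.sqrt (2 * d) * (102 * (d + 1) ^ 2 * L * εU j) +
          2 * (r * (if j = 0 then 3 * ℓ' + (L : ℝ) ^ (n + 1) * (ℓ * η) else 2 * d * (L : ℝ) ^ (n + 1 - j) * (ℓ * η))) *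
            Real.sqrt (2 * (2 * d * (102 * (d + 1) ^ 2 * L * εU j) ^ 2 + ((L : ℝ) ^ d)⁻¹))))) -
        ∏ j ∈ Finset.range (n + 1), (1 + Real.sqrt ((L : ℝ) ^ d) * (Real.sqrt (2 * d) * (102 * (d + 1) ^ 2 * L * εU j)))) ≤ β)
    (hβKw : 8 * (r * (ℓ * η)) * (768 * Fintype.card (DirPair d) * Mτ * Mφ ^ 2 * (‖((η : ℂ)) ^ d‖ / c₀) * ‖((η : ℂ))⁻¹‖ ^ 2 * δpl) ≤ βK)
    (hβ'D : 2 * r * ℓ * (Mφ * Mφ') * Real.sqrt d ≤ β') (hβ'Q : 2 * r * ℓ' * M ≤ β')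
    (smallG : 3 * (1 + a') * β' ^ 2 ≤ γ' / 4) (hwinκ : 12 * (β' * (4 / γ' + M * ((4 / γ') ^ 2 * (3 + a' * (2 * M + 1))))) ≤ Real.sqrt κ₁)
    (hρw : (6 * (β' * (4 / γ' + M * ((4 / γ') ^ 2 * (3 + a' * (2 * M + 1))))) + 9 * (β' * (4 / γ' + M * ((4 / γ') ^ 2 * (3 + a' * (2 * M + 1)))))) /
      Real.sqrt κ₁ ≤ ρ)
    {δQ : ℝ} (hδQ : δQ = Mφ' * Mφ * Real.sqrt (c₁ / (c₀ * ((L : ℝ) ^ (n + 1)) ^ d)) *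
        ((∏ j ∈ Finset.range (n + 1), (1 + Real.sqrt ((L : ℝ) ^ d) * (Real.sqrt (2 * d) * (102 * (d + 1) ^ 2 * L * εU j) +
            2 * (r * (if j = 0 then 3 * ℓ' + (L : ℝ) ^ (n + 1) * (ℓ * η) else 2 * d * (L : ℝ) ^ (n + 1 - j) * (ℓ * η))) *
              Real.sqrt (2 * (2 * d * (102 * (d + 1) ^ 2 * L * εU j) ^ 2 + ((L : ℝ) ^ d)⁻¹))))) *
          ((∏ j ∈ Finset.range (n + 1), (1 + Real.sqrt ((L : ℝ) ^ d) *
              ((1 + 2 * (r * (if j = 0 then 3 * ℓ' + (L : ℝ) ^ (n + 1) * (ℓ * η) else 2 * d * (L : ℝ) ^ (n + 1 - j) * (ℓ * η)))) * (2 * d) *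
                (75497472 * ((d : ℝ) + 1) * ((2 * (d * L) + L + L : ℕ) : ℝ) * δUV j)))) - 1)))
    (PB : TSite d m → BondL2K ℂ d (towerP L m (n + 1)) c₀ W →L[ℂ] BondL2K ℂ d (towerP L m (n + 1)) c₀ W)
    (hPB : ∀ (y : TSite d m) (f : BondL2K ℂ d (towerP L m (n + 1)) c₀ W) (b : Bond d (towerP L m (n + 1))),
      WL2.equiv ℂ (fun _ : Bond d (towerP L m (n + 1)) => c₀) W (PB y f) b =
        if blockCoord (L ^ (n + 1)) m (siteCast (towerP_eq_fineP_pow L m (n + 1)) (bpos b)) = y then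
          WL2.equiv ℂ (fun _ : Bond d (towerP L m (n + 1)) => c₀) W f b else 0)
    (y₀ y₁ : TSite d m) :
    ‖PB y₁ ∘L (LinearMap.toContinuousLinearMap (G1k L m n φ η V hL α hα1 hU1V hregV τ (c₀ := c₀) (c₁ := c₁) hposV) - LinearMap.toContinuousLinearMap (G1k L m n φ η U hL α hα1 hU1U hregU τ (c₀ := c₀) (c₁ := c₁) hposU)) ∘L PB y₀‖ ≤
      (((1 + β) * (4 * Real.exp (r * (ℓ * η)) * (Mφ * Mφ') * (d * Real.sqrt d) * δ) + (4 * Real.exp (r * (ℓ * η)) * (Mφ * Mφ') * (d * Real.sqrt d) * δ) * (1 + β) + (4 * Real.exp (r * (ℓ * η)) * (Mφ * Mφ') * (d * Real.sqrt d) * δ) * (4 * Real.exp (r * (ℓ * η)) * (Mφ * Mφ') * (d * Real.sqrt d) * δ)) +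
          ((1 + Real.sqrt (M / Real.sqrt κ₁) + β) * ((1 + ρ) * (2 * Real.exp (r * (ℓ * η)) * (Mφ * Mφ') * Real.sqrt d * δ) + δR * (1 + Real.sqrt (M / Real.sqrt κ₁) + β)) + (2 * Real.exp (r * (ℓ * η)) * (Mφ * Mφ') * Real.sqrt d * δ) * ((1 + ρ) * (1 + Real.sqrt (M / Real.sqrt κ₁) + β)) +
            (2 * Real.exp (r * (ℓ * η)) * (Mφ * Mφ') * Real.sqrt d * δ) * ((1 + ρ) * (2 * Real.exp (r * (ℓ * η)) * (Mφ * Mφ') * Real.sqrt d * δ) + δR * (1 + Real.sqrt (M / Real.sqrt κ₁) + β))) +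
          (Real.exp (2 * (r * (ℓ * η))) * (16 * d * Cτ * Mφ ^ 2 * (|η| ^ d / c₀) * (‖((η : ℂ))⁻¹‖ ^ 2 * (12 * (δ * η) * ε + 3 * δp)))) + ((Real.sqrt a + |a| * β) * δQ + δQ * (Real.sqrt a + |a| * β) + |a| * (δQ * δQ))) / min (1 / 4) (γ / 8) *
        ((1 + (8 * Real.sqrt d * (Mφ * Mφ') * δ + 2 * Mφ * Mφ' * δ * Real.sqrt d + (max (3 * sA₂ / sV) (2 / δ₀) * δ) * (1 + Real.sqrt (M / Real.sqrt κ₁)) + Real.sqrt a *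
          (Mφ' * Mφ * Real.sqrt (c₁ / (c₀ * ((L : ℝ) ^ (n + 1)) ^ d)) * (2 * Real.exp (Real.sqrt ((L : ℝ) ^ d) * (Real.sqrt (2 * d) * (102 * (d + 1) ^ 2 * L)) * (αb / (1 - rp))) * (Real.sqrt ((L : ℝ) ^ d) * (Real.sqrt (2 * d) * (75497472 * ((d : ℝ) + 1) * ((2 * (d * L) + L + L : ℕ) : ℝ))) / (1 - rp) * δ))))) * (min (1 / 4) (γ / 8))⁻¹) * Real.exp r * Real.exp (-(r * tdist m y₀ y₁)) := by
  have hKreU : ∀ f : BondL2K ℂ d (towerP L m (n + 1)) c₀ W,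
      -((768 * Fintype.card (DirPair d) * Mτ * Mφ ^ 2 * (‖((η : ℂ)) ^ d‖ / c₀) * ‖((η : ℂ))⁻¹‖ ^ 2 * δpl) * ‖f‖ ^ 2) ≤
        RCLike.re ⟪f, curvOp φ τ η U f⟫_ℂ :=
    fun f => re_inner_curvOp_self_ge φ hφ hstar τ hτ2 hMτ η U (fun b => B7Prop1Explicit.mem_U1.mp (hU b)) hδpl hReU hImU f
  have hKreV : ∀ f : BondL2K ℂ d (towerP L m (n + 1)) c₀ W,
      -((768 * Fintype.card (DirPair d) * Mτ * Mφ ^ 2 * (‖((η : ℂ)) ^ d‖ / c₀) * ‖((η : ℂ))⁻¹‖ ^ 2 * δpl) * ‖f‖ ^ 2) ≤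
        RCLike.re ⟪f, curvOp φ τ η V f⟫_ℂ :=
    fun f => re_inner_curvOp_self_ge φ hφ hstar τ hτ2 hMτ η V (fun b => B7Prop1Explicit.mem_U1.mp (hV b)) hδpl hReV hImV f
  exact norm_block_G1k_sub_G1k_le_lipschitz_curv_Q φ hφ hφ' hMφ hMφ' hη hηL U V hU hV hRSU hRSV τ hL α hα1 hU1U hregU hU1V hregV a
    ha hm hposU hposV hγ hβ hℓ hℓ' hr hρ hρ8 (by positivity) hcoerU hcoerV hKreU hKreV hwin hβCC hβC hβD
    (hQK_of_chain_tower L m n φ hφ hφ' hMφ hMφ' hstar hη U hU hRSU τ hτ2 hMτ hL hm α hα1 hU1U hregU εU hεU hLεU hδpl hReU hImU ha'.le hpos'U hγ' hγ'1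
      hκ₁ hM coerciveU hκU hMQU hℓ hℓ' hβ'0 hβ'1 hwin hwinQ0 hwinQ1 hwin' hβT hβKw hβ'D hβ'Q smallG hwinκ hρw)
    (hQK_of_chain_tower L m n φ hφ hφ' hMφ hMφ' hstar hη V hV hRSV τ hτ2 hMτ hL hm α hα1 hU1V hregV εU hεU hLεV hδpl hReV hImV ha'.le hpos'V hγ' hγ'1
      hκ₁ hM coerciveV hκV hMQV hℓ hℓ' hβ'0 hβ'1 hwin hwinQ0 hwinQ1 hwin' hβT hβKw hβ'D hβ'Q smallG hwinκ hρw)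
    (norm_one_sub_RofUk_covDivL2K_le_sqrt L m n φ c₀ η U c₁ a' hRSU hpos'U ha'.le hM hκ₁ hMQU hκU)
    (norm_one_sub_RofUk_covDivL2K_le_sqrt L m n φ c₀ η V c₁ a' hRSV hpos'V ha'.le hM hκ₁ hMQV hκV)
    small hδR hTR hδ hUV hstar hτ hCτ hε hpl hδp hpp hw ha' hαb hUε hVε εU δUV hεU hδUV hLεU hLεV hLbU hLbV hLUV hrp0 hrp1 hαα₀ hδ₀ hεg hδg hsD hsQ hθb
    hδbD hγRdef hθbG hδbA hsS hsV hs₂ hsG₂ hsA₂ hc1 hγR hDγ hsV0 hB hwinR hα128 hδmax hwinQ hwinQ0 hwinQ1 hδQ PB hPB y₀ y₁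

end Literature.MathematicalPhysics.QuantumFieldTheory.Balaban1983to89.B9Eq326DeltaABlockDecayTowerTwoBackgroundsClosed

end
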